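import Mathlib.LinearAlgebra.Matrix.GeneralLinearGroup.Defs
import Mathlib.Data.Matrix.Basic
import Mathlib.Algebra.BigOperators.Group.Finset.Basic
import Literature.RepresentationTheory.FiniteGroups.NumberOfIrreducibles
import HarnessLib

/-!
# Gurevich–Howe: the strict tensor rank filtration of `Irr(GL_n(𝔽_q))` and the eta-correspondence
# count

Topic `Literature/RepresentationTheory/FiniteGroups`; cite item `wi-48508` (route
`MatrixMultiplication/LevelGradedCohnUmans`: sharp count of the irreducible characters of
`GL_n(𝔽_q)` of tensor rank `≤ k`).

## Source

S. Gurevich, R. Howe, *Harmonic analysis on `GL_n` over finite fields*, Pure Appl. Math. Q. 17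
(2021) = arXiv:2105.12369 (`GurevichHowe2021`), §2.2 and §6; and S. Gurevich, R. Howe, *Rank and
duality in representation theory*, Jpn. J. Math. 15 (2020) (`GurevichHowe2020`), §0.4, §9.

* §2.2 (TRF): `ω` is the permutation representation of `GL_n` on `L²(𝔽_qⁿ)`,
  `[ω(g) f](x) = f(g⁻¹ x)`; `ω^{⊗k}` its `k`-fold tensor power, i.e. the permutation representation
  on `k`-tuples of vectors = `n × k` matrices (GH2020 Rem. 9.1.1: "this `k`-fold tensor product is
  just the natural permutation representation on `k` copies of `𝔽_qⁿ` … on the space of `n × k`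
  matrices, by multiplication on the left"); `\widehat{GL}_n(ω^{⊗k})` = the set of irreps of `GL_n`
  that appear in `ω^{⊗k}`; Prop. 4: `{1} ⊊ \widehat{GL}_n(ω^{⊗1}) ⊊ … ⊊ \widehat{GL}_n(ω^{⊗n}) = Irr`.
* §2.2 Def. 1: an irrep `ρ` is of **strict tensor rank `k`** if its first occurrence in (TRF) is in
  `\widehat{GL}_n(ω^{⊗k})`; the set of these is `(\widehat{GL}_n)^⋆_{⊗,k}`.
* §6.2, Theorem (eta correspondence — explicit form) [Thm. 22 of the arXiv version; GH2020
  Thm. 0.4.8 / Thm. 9.2.3 for the domain, Thm. 0.4.4 / Cor. 19 for the bijection], last clause: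
  "the mapping `τ ↦ η(τ)` gives an explicit bijective correspondence between the collection
  `(\widehat{GL}_k)^⋆_{⊗, ≥ 2k−n}` of irreps of `GL_k` of strict tensor rank `≥ 2k − n`, and the
  set `(\widehat{GL}_n)^⋆_{⊗,k}` of strict tensor rank `k` irreps of `GL_n`" (`0 ≤ k ≤ n`).

## Content (characters index the irreps, as everywhere in this topic)

* `GLn.tensorPermChar F n k` — the character of `ω^{⊗k}`: `g ↦ #{M ∈ M_{n×k}(F) : g M = M}`.
* `GLn.tensorSpectrum F n k = \widehat{GL}_n(ω^{⊗k})` — irreducible characters `χ` with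
  `⟨χ, ω^{⊗k}⟩ ≠ 0`; `GLn.strictTensorRankSpectrum F n k = (\widehat{GL}_n)^⋆_{⊗,k}` — first
  occurrence at step `k`.
* NAMED FACT `GurevichHowe2021_etaCorrespondence_card` — the CARDINALITY form of the last clause
  of the theorem: `#(\widehat{GL}_n)^⋆_{⊗,k} = #(\widehat{GL}_k)^⋆_{⊗, ≥ 2k−n}` for `k ≤ n`
  (statement only; weaker than the printed bijection `η`, whose definition needs the
  `(GL_k × GL_n)`-isotypic decomposition of `L²(M_{k,n})`).
  `-- TODO(general form): the bijection η itself (η(τ) = the unique strict-tensor-rank-k`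
  `-- constituent of the τ-isotypic part Θ(τ) of ω_{kn}, multiplicity one).`
* PROVED from the fact: in the stable range `2k ≤ n` the right-hand side is all of `Irr(GL_k)`, so
  `#(\widehat{GL}_n)^⋆_{⊗,k} = #Irr(GL_k(F)) = #`conjugacy classes of `GL_k(F)`
  (`…card.strict_eq_card_conjClasses`, via `ncard_irrChars_eq_card_conjClasses`, Serre §2.5 Thm 7),
  and the cumulative count `#{χ : χ occurs in ω^{⊗l} for some l ≤ k} = ∑_{j ≤ k} #Cl(GL_j(F))`
  (`…card.cumulative_eq_sum_card_conjClasses`) — the form route LevelGradedCohnUmans consumes.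

## Not here

The tensor rank (non-strict, up to twisting by characters of `GL_n`), the `U`-rank, the
oscillator-representation formalism, Prop. 4 (monotonicity of the spectra — the cumulative count is
therefore stated over `⋃_{l ≤ k}` rather than over `\widehat{GL}_n(ω^{⊗k})`), and any identification
with spans of matrix coefficients / Fourier modes of rank `≤ k` (problem-side).
-/

noncomputable section

open scoped BigOperators

namespace Literature.RepresentationTheory.FiniteGroups

namespace GLn

variable (F : Type) [Field F] [Fintype F]

open scoped Classical in
/-- The character of `ω^{⊗k}`, the permutation representation of `GL_n(F)` on `k`-tuples of
column vectors = `n × k` matrices under left multiplication: `g ↦ #{M ∈ M_{n×k}(F) : g M = M}`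
(the character of a permutation representation is the number of fixed points).
[cite: GurevichHowe2021, §2.2 (TRF) (ω and ω^{⊗k})] [cite: GurevichHowe2020, Rem. 9.1.1] -/
def tensorPermChar (n k : ℕ) (g : Matrix.GeneralLinearGroup (Fin n) F) : ℂ :=
  ((Finset.univ.filter fun M : Matrix (Fin n) (Fin k) F =>
      (g : Matrix (Fin n) (Fin n) F) * M = M).card : ℂ)


/-- `ω^{⊗0}` is the trivial representation: there is exactly one `n × 0` matrix, so its character is
identically `1`. [cite: GurevichHowe2021, §2.2 (TRF) (the term `{1}` of the filtration)] -/
theorem tensorPermChar_zero (n : ℕ) (g : Matrix.GeneralLinearGroup (Fin n) F) :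
    tensorPermChar F n 0 g = 1 := by
  classical
  unfold tensorPermChar
  have h : (Finset.univ.filter fun M : Matrix (Fin n) (Fin 0) F =>
      (g : Matrix (Fin n) (Fin n) F) * M = M) = Finset.univ := by
    refine Finset.filter_true_of_mem fun M _ => ?_
    ext i j
    exact j.elim0
  rw [h, Finset.card_univ, Nat.cast_eq_one, Fintype.card_eq_one_iff]
  exact ⟨0, fun M => Matrix.ext fun _ j => j.elim0⟩

/-- At the identity every matrix is fixed: `ω^{⊗k}(1) = dim L²(M_{n×k}(F)) = |F|^{n k}`.
[cite: GurevichHowe2021, §2.2 (TRF)] -/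
theorem tensorPermChar_one (n k : ℕ) :
    tensorPermChar F n k 1 = ((Fintype.card F) ^ (n * k) : ℕ) := by
  classical
  unfold tensorPermChar
  have h : (Finset.univ.filter fun M : Matrix (Fin n) (Fin k) F =>
      ((1 : Matrix.GeneralLinearGroup (Fin n) F) : Matrix (Fin n) (Fin n) F) * M = M) =
        Finset.univ := by
    refine Finset.filter_true_of_mem fun M _ => ?_
    simp
  rw [h, Finset.card_univ]
  congr 1
  rw [show Fintype.card (Matrix (Fin n) (Fin k) F) = Fintype.card (Fin n → Fin k → F) from rfl,
    Fintype.card_fun, Fintype.card_fun, Fintype.card_fin, Fintype.card_fin, ← pow_mul, mul_comm]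

open scoped Classical in
/-- The **`k`-spectrum** `\widehat{GL}_n(ω^{⊗k})`: the irreducible characters `χ` of `GL_n(F)` that
appear in `ω^{⊗k}`, i.e. with `⟨χ, ω^{⊗k}⟩ ≠ 0` (scalar product of class functions `classInner`,
Serre §7.2). [cite: GurevichHowe2021, §2.2 Prop. 4 (the sets \widehat{GL}_n(ω^{⊗k}))] -/
def tensorSpectrum (n k : ℕ) : Set (Matrix.GeneralLinearGroup (Fin n) F → ℂ) :=
  {χ | χ ∈ irrChars (Matrix.GeneralLinearGroup (Fin n) F) ∧ classInner χ (tensorPermChar F n k) ≠ 0}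

/-- The irreducible characters of `GL_n(F)` of **strict tensor rank `k`**, `(\widehat{GL}_n)^⋆_{⊗,k}`:
those whose first occurrence in the filtration `\widehat{GL}_n(ω^{⊗l})`, `l = 0, 1, …`, is at
`l = k`. [cite: GurevichHowe2021, §2.2 Def. 1 (strict tensor rank)] -/
def strictTensorRankSpectrum (n k : ℕ) : Set (Matrix.GeneralLinearGroup (Fin n) F → ℂ) :=
  {χ | χ ∈ tensorSpectrum F n k ∧ ∀ l < k, χ ∉ tensorSpectrum F n l}

/-- The irreducible characters of `GL_n(F)` occurring in `ω^{⊗l}` for SOME `l ≤ k`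
(`⋃_{l ≤ k} \widehat{GL}_n(ω^{⊗l})`; by GH2021 Prop. 4, not used here, this is `\widehat{GL}_n(ω^{⊗k})`
itself). [cite: GurevichHowe2021, §2.2 Prop. 4] -/
def tensorSpectrumLE (n k : ℕ) : Set (Matrix.GeneralLinearGroup (Fin n) F → ℂ) :=
  {χ | ∃ l ≤ k, χ ∈ tensorSpectrum F n l}

end GLn

/-- **Gurevich–Howe, the eta correspondence (`(GL_k, GL_n)`-duality), cardinality form.**  For a
finite field `F` and `0 ≤ k ≤ n`, the map `τ ↦ η(τ)` is a bijection from the irreps of `GL_k(F)`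
of strict tensor rank `≥ 2k − n` onto the irreps of `GL_n(F)` of strict tensor rank `k`
(Gurevich–Howe 2021, §6.2, Theorem "eta correspondence — explicit form", last clause; the domain
is GH2020 Thm. 0.4.8 / Thm. 9.2.3, the bijection GH2020 Thm. 0.4.4 (0.4.5)).  Vendored here is the
consequence `#(\widehat{GL}_n)^⋆_{⊗,k} = #(\widehat{GL}_k)^⋆_{⊗, ≥ 2k−n}`, with "strict tensor rank
`≥ r`" rendered as "occurs in no `ω^{⊗l}`, `l < r`" and `2k − n` truncated at `0` (for `2k ≤ n` the
condition is vacuous and the right-hand side is all of `Irr(GL_k(F))`).  Statement only.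
[cite: GurevichHowe2021, §6.2 Thm. (eta correspondence, explicit form), last clause]
[cite: GurevichHowe2020, Thm. 0.4.8] -/
def GurevichHowe2021_etaCorrespondence_card : Prop :=
  ∀ (F : Type) [Field F] [Fintype F] (n k : ℕ), k ≤ n →
    (GLn.strictTensorRankSpectrum F n k).ncard =
      {τ | τ ∈ irrChars (Matrix.GeneralLinearGroup (Fin k) F) ∧
            ∀ l < 2 * k - n, τ ∉ GLn.tensorSpectrum F k l}.ncard

-- TODO(general form): the bijection `η` itself — `η(τ)` is the unique constituent of strict tensor
-- rank `k` of the `τ`-isotypic component `Θ(τ)` of `ω_{kn} = L²(M_{k,n})`, with multiplicity one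
-- (GH2021 §6.2 Thm., parts Existence/Uniqueness/Formula).

namespace GLn

variable {F : Type} [Field F] [Fintype F] {n : ℕ}

/-- `(\widehat{GL}_n)^⋆_{⊗,k} ⊆ Irr(GL_n)`. [cite: GurevichHowe2021, §2.2 Def. 1] -/
theorem strictTensorRankSpectrum_subset_irrChars (k : ℕ) :
    strictTensorRankSpectrum F n k ⊆ irrChars (Matrix.GeneralLinearGroup (Fin n) F) :=
  fun _ h => h.1.1

/-- `⋃_{l ≤ k} \widehat{GL}_n(ω^{⊗l}) ⊆ Irr(GL_n)`. [cite: GurevichHowe2021, §2.2 Prop. 4] -/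
theorem tensorSpectrumLE_subset_irrChars (k : ℕ) :
    tensorSpectrumLE F n k ⊆ irrChars (Matrix.GeneralLinearGroup (Fin n) F) :=
  fun _ ⟨_, _, h⟩ => h.1

/-- `(\widehat{GL}_n)^⋆_{⊗,k}` is finite. [cite: GurevichHowe2021, §2.2 Def. 1] -/
theorem strictTensorRankSpectrum_finite (k : ℕ) : (strictTensorRankSpectrum F n k).Finite :=
  (irrChars_finite_holds _).subset (strictTensorRankSpectrum_subset_irrChars k)

/-- `⋃_{l ≤ k} \widehat{GL}_n(ω^{⊗l})` is finite. [cite: GurevichHowe2021, §2.2 Prop. 4] -/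
theorem tensorSpectrumLE_finite (k : ℕ) : (tensorSpectrumLE F n k).Finite :=
  (irrChars_finite_holds _).subset (tensorSpectrumLE_subset_irrChars k)

/-- Irreps of two different strict tensor ranks are different (first occurrence is unique).
[cite: GurevichHowe2021, §2.2 Def. 1] -/
theorem disjoint_strictTensorRankSpectrum {j k : ℕ} (hjk : j ≠ k) :
    Disjoint (strictTensorRankSpectrum F n j) (strictTensorRankSpectrum F n k) := by
  rw [Set.disjoint_left]
  rintro χ ⟨hj, hj'⟩ ⟨hk, hk'⟩
  rcases lt_or_gt_of_ne hjk with h | h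
  · exact hk' j h hj
  · exact hj' k h hk

/-- The first `k + 1` layers exhaust `⋃_{l ≤ k+1}`: `⋃_{l ≤ k+1} \widehat{GL}_n(ω^{⊗l}) =
(⋃_{l ≤ k} \widehat{GL}_n(ω^{⊗l})) ∪ (\widehat{GL}_n)^⋆_{⊗,k+1}`. [cite: GurevichHowe2021, §2.2 Def. 1] -/
theorem tensorSpectrumLE_succ (k : ℕ) :
    tensorSpectrumLE F n (k + 1) = tensorSpectrumLE F n k ∪ strictTensorRankSpectrum F n (k + 1) := by
  ext χ
  constructor
  · rintro ⟨l, hl, hχ⟩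
    by_cases hU : χ ∈ tensorSpectrumLE F n k
    · exact Or.inl hU
    · refine Or.inr ⟨?_, fun l' hl' hχ' => hU ⟨l', Nat.lt_succ_iff.mp hl', hχ'⟩⟩
      rcases Nat.lt_or_ge l (k + 1) with h | h
      · exact absurd ⟨l, Nat.lt_succ_iff.mp h, hχ⟩ hU
      · obtain rfl : l = k + 1 := le_antisymm hl h
        exact hχ
  · rintro (⟨l, hl, hχ⟩ | ⟨hχ, -⟩)
    · exact ⟨l, hl.trans (Nat.le_succ k), hχ⟩
    · exact ⟨k + 1, le_rfl, hχ⟩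

/-- Layer zero: `⋃_{l ≤ 0} \widehat{GL}_n(ω^{⊗l}) = (\widehat{GL}_n)^⋆_{⊗,0}`.
[cite: GurevichHowe2021, §2.2 Def. 1] -/
theorem tensorSpectrumLE_zero : tensorSpectrumLE F n 0 = strictTensorRankSpectrum F n 0 := by
  ext χ
  constructor
  · rintro ⟨l, hl, hχ⟩
    obtain rfl : l = 0 := Nat.le_zero.mp hl
    exact ⟨hχ, fun l hl => absurd hl (Nat.not_lt_zero l)⟩
  · rintro ⟨hχ, -⟩
    exact ⟨0, le_rfl, hχ⟩

/-- `⋃_{l ≤ k}` and the next layer are disjoint. [cite: GurevichHowe2021, §2.2 Def. 1] -/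
theorem disjoint_tensorSpectrumLE_strict (k : ℕ) :
    Disjoint (tensorSpectrumLE F n k) (strictTensorRankSpectrum F n (k + 1)) := by
  rw [Set.disjoint_left]
  rintro χ ⟨l, hl, hχ⟩ ⟨-, h'⟩
  exact h' l (Nat.lt_succ_of_le hl) hχ

end GLn

/-- **Stable range of the eta correspondence** (`2k ≤ n`): the number of irreducible characters
of `GL_n(F)` of strict tensor rank `k` equals the number of conjugacy classes of `GL_k(F)` — from the
cardinality form of the eta correspondence (the domain `(\widehat{GL}_k)^⋆_{⊗,≥2k−n}` is all of
`Irr(GL_k)` when `2k ≤ n`) and `#Irr = #`conjugacy classes (Serre §2.5 Thm. 7, proved in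
`NumberOfIrreducibles`). [cite: GurevichHowe2021, §6.2 Thm. (eta correspondence, explicit form)]
[cite: GurevichHowe2020, Thm. 0.4.8 (domain of the eta correspondence)] -/
theorem GurevichHowe2021_etaCorrespondence_card.strict_eq_card_conjClasses
    (h : GurevichHowe2021_etaCorrespondence_card) (F : Type) [Field F] [Fintype F]
    {n k : ℕ} (hk : 2 * k ≤ n) :
    (GLn.strictTensorRankSpectrum F n k).ncard =
      Nat.card (ConjClasses (Matrix.GeneralLinearGroup (Fin k) F)) := by
  classical
  have hkn : k ≤ n := by omega
  rw [h F n k hkn, ← ncard_irrChars_eq_card_conjClasses]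
  congr 1
  ext τ
  simp only [Set.mem_setOf_eq, Nat.sub_eq_zero_of_le hk, Nat.not_lt_zero, false_imp_iff,
    implies_true, and_true]

/-- **Cumulative count in the stable range** (`2k ≤ n`): the number of irreducible characters of
`GL_n(F)` occurring in `ω^{⊗l}` for some `l ≤ k` is `∑_{j=0}^{k} #Cl(GL_j(F))` — the layers
`(\widehat{GL}_n)^⋆_{⊗,j}`, `j ≤ k`, partition that set and each has `#Cl(GL_j(F))` members.  This is
the sharp replacement for the elementary bound `p^{4k²}` used by route
`MatrixMultiplication/LevelGradedCohnUmans`. [cite: GurevichHowe2021, §6.2 Thm. (eta correspondence, explicit form) and §2.2 Def. 1]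
[cite: GurevichHowe2020, Thm. 0.4.8 (domain of the eta correspondence)] -/
theorem GurevichHowe2021_etaCorrespondence_card.cumulative_eq_sum_card_conjClasses
    (h : GurevichHowe2021_etaCorrespondence_card) (F : Type) [Field F] [Fintype F]
    {n k : ℕ} (hk : 2 * k ≤ n) :
    (GLn.tensorSpectrumLE F n k).ncard =
      ∑ j ∈ Finset.range (k + 1), Nat.card (ConjClasses (Matrix.GeneralLinearGroup (Fin j) F)) := by
  induction k with
  | zero =>
    rw [GLn.tensorSpectrumLE_zero, Finset.sum_range_one]
    exact h.strict_eq_card_conjClasses F hk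
  | succ k ih =>
    rw [GLn.tensorSpectrumLE_succ, Set.ncard_union_eq (GLn.disjoint_tensorSpectrumLE_strict k)
      (GLn.tensorSpectrumLE_finite k) (GLn.strictTensorRankSpectrum_finite (k + 1)),
      ih (by omega), h.strict_eq_card_conjClasses F hk, Finset.sum_range_succ _ (k + 1)]

end Literature.RepresentationTheory.FiniteGroups

end
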